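import Summits.Ventures.PercRepro.RankLevelSetLevelSixHeavyCell
import Summits.Ventures.PercRepro.RankLevelSetDepCountHeavySq
import Summits.Ventures.PercRepro.RankLevelSetLevelSix
import Summits.Ventures.PercRepro.S1FourCircuitCount
import Summits.Ventures.PercRepro.RankLevelSetPlaneSix
import Summits.Ventures.PercRepro.S1TriangleCount
import Summits.Ventures.PercRepro.RankLevelSetTriangleStar
import Summits.Ventures.PercRepro.RankLevelSetCorankFiveCounts
import Summits.Ventures.PercRepro.RankLevelSetPlaneTen
import Summits.Ventures.PercRepro.RankLevelSetPlaneTenPrime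
import Summits.Ventures.PercRepro.S1TrianglePlusPlus
import Summits.Ventures.PercRepro.RankLevelSetCoreFour
import Summits.Ventures.PercRepro.RankLevelSetFrameLarge
import Summits.Ventures.PercRepro.RankLevelSetFrameQM
import Summits.Ventures.PercRepro.RankLevelSetLevelFiveAll
import Summits.Ventures.PercRepro.RankLevelSetLevelSixGiant
import Summits.Ventures.PercRepro.RankLevelSetCoreSixLowSelf
import Summits.Ventures.PercRepro.RankLevelSetDepCountHeavyCap

/-!
# PercRepro — THE REGIME-II CELL WITH THE DISJOINT PAIR COUNT AND THE CIRCUIT BOUNDS AS HYPOTHESES (p8 g5, S3)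

`proofs/SUBCLAIM-S3-p8.md` §3r. The regime-II cell theorem `c025_core_six_cell_regII_top'` (RankLevelSetCoreSixLowSelfD: the
heavy-free count with `ν₁ = 34`, the square weights, the tail `A = Σ_{j ≤ 6} C(n, j)·2^33` subtracted from `C(n, p − 1)`)
with the pairs counted by THE DISJOINT PAIR COUNT `Matroid.card_pairsF_le_disj` (`s_k·C(n − k, 7 − k)`) and the triangle /
4-circuit bounds `s₃ ≤ c3`, `s₄ ≤ c4` as HYPOTHESES (so that p1's 4-circuit table and p2's LEMMA Q / T⁺⁺⁺ enter), in place of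
LEMMA T⁺⁺ / T4 in the numeral. At rank `30` the cells `(30, 52 … 58)` close with it (ratios `0.87 … 0.14`) while the
undisjoint form fails at `(30, 52)` (`1.034`). Axioms: standard.
-/

open scoped Matroid

namespace PercRepro

namespace ThmN

open Set

variable {α : Type}

/-- **REGIME II WITH THE DISJOINT PAIR COUNT**: one core cell `(p, d)` from the numeral
`2^{p+6}/C(p+6, 6)·(C(n, 6) + (σ(min(f′ − 6, 32)) + σ(32))·P(n)) + A(n) ≤ C(n, p − 1)` with
`P(n) = c3·C(n − 3, 4) + c4·C(n − 4, 3) + C(d + 4, 5)·C(n − 5, 2) + C(d + 5, 6)·(n − 6) + C(d + 6, 7)`. -/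
theorem c025_core_six_cell_regII_top_disj (M : Matroid α) [M.Finite] (p d c3 c4 : ℕ) (_hd7 : 7 ≤ d) (hp : 1 ≤ p)
    (hs3 : {C | M.IsCircuit C ∧ C.ncard = 3}.ncard ≤ c3) (hs4 : {C | M.IsCircuit C ∧ C.ncard = 4}.ncard ≤ c4)
    (hR : M.eRank = (p : ℕ∞)) (hn : M.E.ncard = p + d)
    (hfree : ∀ e ∈ M.E, ∃ A ⊆ M.E \ {e}, e ∉ M.closure A ∧ e ∉ M.closure ((M.E \ {e}) \ A))
    (hpoly : ((2 : ℚ) ^ (p + 6) / (((p + 6).choose 6 : ℕ) : ℚ)) * ((((p + d).choose 6 : ℕ) : ℚ) +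
      ((∑ i ∈ Finset.range (d - 7 + 1), ((Nat.choose (min (min 19 (5 + d) - 6) (34 - 2)) i : ℕ) : ℚ) / (((i : ℚ) + 1) ^ 2)) *
        (((c3 : ℕ) : ℚ) * ((p + d - 3).choose 4 : ℚ) + ((c4 : ℕ) : ℚ) * ((p + d - 4).choose 3 : ℚ) +
          (((d + 4).choose 5 : ℕ) : ℚ) * ((p + d - 5).choose 2 : ℚ) + (((d + 5).choose 6 : ℕ) : ℚ) * ((p + d - 6 : ℕ) : ℚ) +
          (((d + 6).choose 7 : ℕ) : ℚ)) +
      (∑ i ∈ Finset.range (d - 7 + 1), ((Nat.choose (34 - 2) i : ℕ) : ℚ) / (((i : ℚ) + 1) ^ 2)) *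
        (((c3 : ℕ) : ℚ) * ((p + d - 3).choose 4 : ℚ) + ((c4 : ℕ) : ℚ) * ((p + d - 4).choose 3 : ℚ) +
          (((d + 4).choose 5 : ℕ) : ℚ) * ((p + d - 5).choose 2 : ℚ) + (((d + 5).choose 6 : ℕ) : ℚ) * ((p + d - 6 : ℕ) : ℚ) +
          (((d + 6).choose 7 : ℕ) : ℚ)))) +
      (((∑ j ∈ Finset.range (6 + 1), (p + d).choose j) : ℕ) : ℚ) * 2 ^ 33 ≤ (((p + d).choose (p - 1) : ℕ) : ℚ)) :
    RLS M p 6 := by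
  classical
  have hEcard : M.ground_finite.toFinset.card = p + d := by
    rw [← Set.ncard_eq_toFinset_card _ M.ground_finite]; exact hn
  -- the core is simple: every circuit has `≥ 3` elements
  have hL : ∀ e ∈ M.E, ¬ M.IsLoop e := not_isLoop_of_free M hfree
  have hs : ∀ e ∈ M.E, ∀ f ∈ M.E, e ≠ f → M.eRk {e, f} = 2 := by
    intro e he f hf hef
    have h2 : (2 : ℕ∞) ≤ M.eRk {e, f} :=
      two_le_eRk_of_two_le_ncard_of_free M hfree (pair_subset he hf) (by rw [ncard_pair hef])
    have h3 : M.eRk {e, f} ≤ 2 := by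
      have := M.eRk_le_encard {e, f}
      rwa [encard_pair hef] at this
    exact le_antisymm h3 h2
  have hcirc : ∀ C, M.IsCircuit C → 3 ≤ C.encard := three_le_encard_of_circuit M hL hs
  have hd : M.E.encard = M.eRank + d := by
    rw [hR, ← M.ground_finite.cast_ncard_eq, hn]
    push_cast
    ring
  -- the nullity cap: every `X ⊆ E` has `|X| ≤ r(X) + d`
  have hcap : ∀ X ⊆ M.E, ∀ k : ℕ, M.eRk X ≤ k → X.ncard ≤ k + d := by
    intro X hX k hr
    have h1 := Matroid.encard_le_eRk_add_of_encard_eq hX hd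
    have h2 : X.encard ≤ (k : ℕ∞) + d := h1.trans (by gcongr)
    have hfin : X.Finite := M.ground_finite.subset hX
    rw [← hfin.cast_ncard_eq] at h2
    exact_mod_cast h2
  have hflat : ∀ X ⊆ M.E, M.eRk X ≤ 6 → X.ncard ≤ min 39 (6 + d) :=
    fun X hX hr => le_min (ncard_le_thirtynine_of_eRk_le_six_of_free M hfree hX hr) (hcap X hX 6 hr)
  have hflat' : ∀ X ⊆ M.E, M.eRk X ≤ ((6 - 1 : ℕ) : ℕ∞) → X.ncard ≤ min 19 (5 + d) :=
    fun X hX hr => le_min (ncard_le_nineteen_of_eRk_le_five_of_free M hfree hX (by simpa using hr))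
      (hcap X hX 5 (by simpa using hr))
  -- (U): the heavy / light count
  have hU1 := Matroid.topCount_le_ncard_compl (M := M) hR hd 6
  have hG := Matroid.ncard_eRk_eq_ncard_le_le_heavy_sq M 6 (min 19 (5 + d)) 34 (by norm_num) hcirc d
  -- the pair classes
  have hPs : (((Matroid.pairsLight M 6 34).filter (fun p => p ∈ Matroid.pairsSmall M 6 (min 19 (5 + d)))).card : ℚ) ≤
      ∑ k ∈ Finset.Icc 3 (6 + 1), ({C | M.IsCircuit C ∧ C.ncard = k}.ncard : ℚ) * (((M.E.ncard - k).choose (6 + 1 - k) : ℕ) : ℚ) := by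
    have h1 := (Matroid.card_pairsLightSmall_le (M := M) 6 (min 19 (5 + d)) 34).trans (Matroid.card_pairsF_le_disj 6)
    have : ((((Matroid.pairsLight M 6 34).filter (fun p => p ∈ Matroid.pairsSmall M 6 (min 19 (5 + d)))).card : ℕ) : ℚ) ≤
        ((∑ k ∈ Finset.Icc 3 (6 + 1), {C | M.IsCircuit C ∧ C.ncard = k}.ncard * (M.E.ncard - k).choose (6 + 1 - k) : ℕ) : ℚ) := by
      exact_mod_cast h1
    push_cast at this
    exact this
  have hPb : (((Matroid.pairsLight M 6 34).filter (fun p => p ∉ Matroid.pairsSmall M 6 (min 19 (5 + d)))).card : ℚ) ≤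
      ∑ k ∈ Finset.Icc 3 (6 + 1), ({C | M.IsCircuit C ∧ C.ncard = k}.ncard : ℚ) * (((M.E.ncard - k).choose (6 + 1 - k) : ℕ) : ℚ) := by
    have h1 := (Matroid.card_pairsBigLight_le (M := M) 6 (min 19 (5 + d)) 34).trans (Matroid.card_pairsF_le_disj 6)
    have : ((((Matroid.pairsLight M 6 34).filter (fun p => p ∉ Matroid.pairsSmall M 6 (min 19 (5 + d)))).card : ℕ) : ℚ) ≤
        ((∑ k ∈ Finset.Icc 3 (6 + 1), {C | M.IsCircuit C ∧ C.ncard = k}.ncard * (M.E.ncard - k).choose (6 + 1 - k) : ℕ) : ℚ) := by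
      exact_mod_cast h1
    push_cast at this
    exact this
  -- the heavy sets: none (`ν₁ = 34`: a heavy closure would have `≥ 40` points)
  have hHv : ({B : Set α | B ⊆ M.E ∧ M.eRk B = (6 : ℕ) ∧ 6 + 34 ≤ (M.closure B).ncard}.ncard : ℚ) ≤ 0 := by
    have hempty : {B : Set α | B ⊆ M.E ∧ M.eRk B = (6 : ℕ) ∧ 6 + 34 ≤ (M.closure B).ncard} = ∅ := by
      ext B
      simp only [Set.mem_setOf_eq, Set.mem_empty_iff_false, iff_false]
      rintro ⟨hB, hr, hcl⟩
      have h39 : (M.closure B).ncard ≤ min 39 (6 + d) :=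
        hflat _ (M.closure_subset_ground B) (by rw [M.eRk_closure_eq]; exact hr.le)
      have : min 39 (6 + d) ≤ 39 := min_le_left _ _
      omega
    rw [hempty, Set.ncard_empty]
    simp
  -- the circuit bounds
  have hC1 : ∀ L ⊆ M.E, M.eRk L = 2 → L.ncard ≤ 3 :=
    fun L hL hr => ncard_le_three_of_eRk_two M hs hfree hL hr
  have hs5 : {C | M.IsCircuit C ∧ C.ncard = 5}.ncard ≤ (d + 4).choose 5 :=
    Matroid.ncard_circuits_le_choose_of_encard M hd 4
  have hs6 : {C | M.IsCircuit C ∧ C.ncard = 6}.ncard ≤ (d + 5).choose 6 :=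
    Matroid.ncard_circuits_le_choose_of_encard M hd 5
  have hs7 : {C | M.IsCircuit C ∧ C.ncard = 7}.ncard ≤ (d + 6).choose 7 :=
    Matroid.ncard_circuits_le_choose_of_encard M hd 6
  have hs3q : ({C | M.IsCircuit C ∧ C.ncard = 3}.ncard : ℚ) ≤ ((c3 : ℕ) : ℚ) := by exact_mod_cast hs3
  have hs4q : ({C | M.IsCircuit C ∧ C.ncard = 4}.ncard : ℚ) ≤ ((c4 : ℕ) : ℚ) := by exact_mod_cast hs4
  have hs5q : ({C | M.IsCircuit C ∧ C.ncard = 5}.ncard : ℚ) ≤ (((d + 4).choose 5 : ℕ) : ℚ) := by exact_mod_cast hs5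
  have hs6q : ({C | M.IsCircuit C ∧ C.ncard = 6}.ncard : ℚ) ≤ (((d + 5).choose 6 : ℕ) : ℚ) := by exact_mod_cast hs6
  have hs7q : ({C | M.IsCircuit C ∧ C.ncard = 7}.ncard : ℚ) ≤ (((d + 6).choose 7 : ℕ) : ℚ) := by exact_mod_cast hs7
  -- the pair sum in explicit form
  have hPexp : ∑ k ∈ Finset.Icc 3 (6 + 1), ({C | M.IsCircuit C ∧ C.ncard = k}.ncard : ℚ) * (((M.E.ncard - k).choose (6 + 1 - k) : ℕ) : ℚ) ≤
      ((c3 : ℕ) : ℚ) * ((p + d - 3).choose 4 : ℚ) + ((c4 : ℕ) : ℚ) * ((p + d - 4).choose 3 : ℚ) +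
          (((d + 4).choose 5 : ℕ) : ℚ) * ((p + d - 5).choose 2 : ℚ) + (((d + 5).choose 6 : ℕ) : ℚ) * ((p + d - 6 : ℕ) : ℚ) +
          (((d + 6).choose 7 : ℕ) : ℚ) := by
    rw [show (6 : ℕ) + 1 = 7 from rfl, sum_Icc_three_seven_q, hn]
    simp only [show (7 : ℕ) - 3 = 4 from rfl, show (7 : ℕ) - 4 = 3 from rfl, show (7 : ℕ) - 5 = 2 from rfl,
      show (7 : ℕ) - 6 = 1 from rfl, show (7 : ℕ) - 7 = 0 from rfl, Nat.choose_one_right, Nat.choose_zero_right,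
      mul_one, Nat.cast_one]
    gcongr
  set Pq := ((c3 : ℕ) : ℚ) * ((p + d - 3).choose 4 : ℚ) + ((c4 : ℕ) : ℚ) * ((p + d - 4).choose 3 : ℚ) +
          (((d + 4).choose 5 : ℕ) : ℚ) * ((p + d - 5).choose 2 : ℚ) + (((d + 5).choose 6 : ℕ) : ℚ) * ((p + d - 6 : ℕ) : ℚ) +
          (((d + 6).choose 7 : ℕ) : ℚ) with hPq
  have hσ1 : (0 : ℚ) ≤ ∑ i ∈ Finset.range (d - (6 + 1) + 1), ((Nat.choose (min (min 19 (5 + d) - 6) (34 - 2)) i : ℕ) : ℚ) / (((i : ℚ) + 1) ^ 2) :=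
    Finset.sum_nonneg (fun i _ => by positivity)
  have hσ2 : (0 : ℚ) ≤ ∑ i ∈ Finset.range (d - (6 + 1) + 1), ((Nat.choose (34 - 2) i : ℕ) : ℚ) / (((i : ℚ) + 1) ^ 2) :=
    Finset.sum_nonneg (fun i _ => by positivity)
  have hUq : (Matroid.topCount M p 6 : ℚ) ≤ ((p + d).choose 6 : ℚ) +
      ((∑ i ∈ Finset.range (d - 7 + 1), ((Nat.choose (min (min 19 (5 + d) - 6) (34 - 2)) i : ℕ) : ℚ) / (((i : ℚ) + 1) ^ 2)) * Pq +
        (∑ i ∈ Finset.range (d - 7 + 1), ((Nat.choose (34 - 2) i : ℕ) : ℚ) / (((i : ℚ) + 1) ^ 2)) * Pq) := by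
    have h1 : (Matroid.topCount M p 6 : ℚ) ≤
        ({B : Set α | B ⊆ M.E ∧ M.eRk B = 6 ∧ B.ncard ≤ d}.ncard : ℚ) := by exact_mod_cast hU1
    refine h1.trans (hG.trans ?_)
    have e1 := mul_le_mul_of_nonneg_left (hPs.trans hPexp) hσ1
    have e2 := mul_le_mul_of_nonneg_left (hPb.trans hPexp) hσ2
    simp only [show (6 : ℕ) + 1 = 7 from rfl] at e1 e2 ⊢
    rw [hn]
    have h3 := add_le_add (add_le_add (add_le_add (le_refl (((p + d).choose 6 : ℕ) : ℚ)) e1) e2) hHv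
    refine h3.trans (le_of_eq ?_)
    ring
  -- (Y): regime II, the rank-`≤ 6` sets subtracted from the `(p − 1)`-subsets
  have hBj : ∀ j : ℕ, j ≤ 6 → ∀ X ⊆ M.E, M.eRk X ≤ j → X.ncard + 6 ≤ 39 + j := by
    intro j hj X hX hr
    rcases Nat.lt_or_ge j 4 with h | h
    · have := ncard_add_one_le_two_pow_of_eRk_le M hL hfree j X hX hr
      interval_cases j <;> omega
    · rcases Nat.lt_or_ge j 5 with h5 | h5
      · have hj4 : j = 4 := by omega
        subst hj4
        have := ncard_le_ten_of_eRk_le_four_of_free M hfree hX hr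
        omega
      · rcases Nat.lt_or_ge j 6 with h6 | h6
        · have hj5 : j = 5 := by omega
          subst hj5
          have := ncard_le_nineteen_of_eRk_le_five_of_free M hfree hX hr
          omega
        · have hj6 : j = 6 := by omega
          subst hj6
          have := ncard_le_thirtynine_of_eRk_le_six_of_free M hfree hX hr
          omega
  have hA := ncard_eRk_le_le_sum_choose_mul_of_bound M 6 39 hBj
  rw [hEcard] at hA
  have hY := choose_le_midCount_add_low' (M := M) (p := p) (q := 6) hp
  rw [hEcard] at hY
  have hΦ := phiK_le_two_pow_div p 6
  rw [Nat.choose_symm_add] at hΦ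
  rw [RLS_iff]
  have hYq : (((p + d).choose (p - 1) : ℕ) : ℚ) ≤ (Matroid.midCount M p 6 : ℚ) +
      ({X : Set α | X ⊆ M.E ∧ M.eRk X ≤ 6}.ncard : ℚ) := by exact_mod_cast hY
  have hAq : ({X : Set α | X ⊆ M.E ∧ M.eRk X ≤ 6}.ncard : ℚ) ≤
      (((∑ j ∈ Finset.range (6 + 1), (p + d).choose j) : ℕ) : ℚ) * 2 ^ 33 := by
    have : ({X : Set α | X ⊆ M.E ∧ M.eRk X ≤ 6}.ncard : ℚ) ≤
        (((∑ j ∈ Finset.range (6 + 1), (p + d).choose j) * 2 ^ (39 - 6) : ℕ) : ℚ) := by exact_mod_cast hA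
    push_cast at this
    norm_num at this ⊢
    exact this
  have hU0 : (0 : ℚ) ≤ (Matroid.topCount M p 6 : ℚ) := Nat.cast_nonneg _
  have hΦ0 : (0 : ℚ) ≤ (2 ^ (p + 6) : ℚ) / (((p + 6).choose 6 : ℕ) : ℚ) := by positivity
  calc phiK p 6 * (Matroid.topCount M p 6 : ℚ)
      ≤ ((2 ^ (p + 6) : ℚ) / (((p + 6).choose 6 : ℕ) : ℚ)) * (((p + d).choose 6 : ℚ) +
          ((∑ i ∈ Finset.range (d - 7 + 1), ((Nat.choose (min (min 19 (5 + d) - 6) (34 - 2)) i : ℕ) : ℚ) / (((i : ℚ) + 1) ^ 2)) * Pq +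
            (∑ i ∈ Finset.range (d - 7 + 1), ((Nat.choose (34 - 2) i : ℕ) : ℚ) / (((i : ℚ) + 1) ^ 2)) * Pq)) :=
        mul_le_mul hΦ hUq hU0 hΦ0
    _ ≤ (((p + d).choose (p - 1) : ℕ) : ℚ) - (((∑ j ∈ Finset.range (6 + 1), (p + d).choose j) : ℕ) : ℚ) * 2 ^ 33 := by
        rw [hPq]; linarith [hpoly]
    _ ≤ (Matroid.midCount M p 6 : ℚ) := by linarith

end ThmN

end PercRepro
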